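import Literature.AlgebraicGeometry.Motives.HodgeStructurePontryaginProduct
import Literature.AlgebraicGeometry.Motives.HodgeStructureCorrespondencesLefschetzGroup
import HarnessLib

/-!
# The Lefschetz classes `ℚ[B¹(H)]` form a ring under the Pontryagin product: `x, y ∈ ℚ[B¹(H)] ⟹ x ⋆ y = μ_*(p₁^*x ∪ p₂^*y) ∈ ℚ[B¹(H)]`
# (Milne 1999, Cor. 5.5 for the addition map), and the equivariance `⋀γ (x ⋆ y) = ⋀γ x ⋆ ⋀γ y`

[topic AlgebraicGeometry/Motives]

Layer `Literature/AlgebraicGeometry/Motives`, lane `lit-hodgefound` (Track 2 foundations library; prover seat `lit-hodgefound-p34`,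
generation 35, row g35-#6). THEOREMS ONLY (no `def`, no named fact, no instance, no notation; net debt `0`). It joins the seat's two
threads: the PONTRYAGIN PRODUCT `IsSymplectic.pontryagin` of row g35-#2 (`x ⋆ y = μ_*(p₁^*x ∪ p₂^*y)` on `H•(X) = ⋀W`, `μ_*` the Gysin map
`IsSymplectic.pushforward` of `μ^* = ⋀(v ↦ (v, v))`) and MILNE'S LEFSCHETZ CLASSES on the abstract polarized-`ℚ`-Hodge-structure carrier (rows
g18–g34: `S(H)(K) = Polarization.lefschetzGroupBaseChange`, the Lefschetz classes `ℚ[B¹(H)] = Algebra.adjoin ℚ B¹(H)`, Cor. 4.5 in the form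
`Polarization.mem_adjoin_hodgeClasses_two_iff_forall_map_toComplexAlg_eq` "Lefschetz ⟺ fixed by `L(A)` (on `ℂ`-points, through `Θ =
toComplexAlg`)", the complexification lemmas of row g32-#3 `HodgeStructureCorrespondencesLefschetzGroup` and Prop. 5.4 / Cor. 5.5 of
`HodgeStructurePushforwardGraphLefschetz`).

THE SETTING: `H` a polarizable `ℚ`-Hodge structure of odd weight `n` on `V` (`dim V = 2g`) with polarization `Q` — for an abelian variety `A`,
`H = H¹(A, ℚ)`, `V = W = H¹`, `H•(A) = ⋀_ℚ V` —, orientation `E = E_Q = Q.lefschetzClass ∈ B¹(H)` (symplectic of genus `g`,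
`Q.isSymplectic_lefschetzClass hn hg`), `x ⋆ y = (Q.isSymplectic_lefschetzClass hn hg).pontryagin x y`; `Θ = toComplexAlg`, `S(H)(ℂ) =
Q.lefschetzGroupBaseChange ℂ`, `γ ⊕ γ = blockDiag ℂ V V (γ, γ)`, `β = TensorProduct.prodRight ℚ ℂ ℂ V V : (V ⊕ V)_ℂ ≅ V_ℂ ⊕ V_ℂ`.

## Source, and how the printed proof is followed

J. S. Milne, *Lefschetz classes on abelian varieties*, Duke Math. J. 96 (1999) [Milne1999LefschetzClasses] (held text
`paper:milne1999-lefschetz-classes-abelian-varieties`), §5 p. 663: "PROPOSITION 5.4. For any regular map `φ: A → B` of abelian varieties, the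
Gysin map `φ_*` commutes with the actions of `L(A × B)`", "COROLLARY 5.5. The map `φ_*` maps Lefschetz classes on `A` to Lefschetz classes on
`B`. Proof. Because `φ_*` commutes with the actions of `L(A × B)`, it maps classes fixed by `L(A)` to classes fixed by `L(B)`, and we can apply
Corollary 4.5", and (proof of 5.4) "`φ^*` […] is `L`-equivariant". We apply this to the addition map `μ : A × A → A` (`μ^*|H¹ = (v ↦ (v, v))`, a
morphism of Hodge structures `H → H ⊕ H`) and to `p₁^*x ∪ p₂^*y = Φ(x ⊗ y)`: for `γ ∈ S(H)(ℂ)`, `γ ⊕ γ ∈ S(H ⊕ H)(ℂ)` (row g18-#5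
`blockDiag_mem_lefschetzGroupBaseChange_prod_self_iff`, Milne §3 "`S(A) = S(A^r)`"), `⋀(γ ⊕ γ)` fixes `Θ(E ⊞ E) = Θ E_{Q ⊕ Q}` (Cor. 4.5) and
`Θ(p₁^*x ∪ p₂^*y)` (when `x, y` are Lefschetz), and `(μ_*)_ℂ ∘ ⋀(γ ⊕ γ) = ⋀γ ∘ (μ_*)_ℂ` (Prop. 5.4 = row g32-#6 `IsSymplectic.pushforward_map_apply`,
through `μ^*_ℂ ∘ γ = (γ ⊕ γ) ∘ μ^*_ℂ`); hence `⋀γ Θ(x ⋆ y) = Θ(x ⋆ y)` for all `γ ∈ S(H)(ℂ)`, i.e. `x ⋆ y` is Lefschetz (Cor. 4.5). With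
H. Lange, *Abelian Varieties over the Complex Numbers* (2023) [Lange2023AbelianVarietiesComplex], §6.2.3 (p0308: "The Pontryagin product makes
`Ch_•(X)_ℚ` into commutative associative graded rings with identity") this makes `(ℚ[B¹(H)], +, ⋆)` a ring (unit `pt = E^g/g! ∈ ℚ[B¹(H)]`,
associativity ∕ commutativity rows g35-#2, g35-#4).

## What is PROVED

* §1 (every field `K` of characteristic `0`) `map_prodMap_map_inl_add_map_inr` (`⋀(γ₁ × γ₂)(ω₁ ⊞ ω₂) = ⋀γ₁ ω₁ ⊞ ⋀γ₂ ω₂`) and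
  **`IsSymplectic.map_pontryagin`: `⋀γ (x ⋆ y) = ⋀γ x ⋆ ⋀γ y` for every `γ ∈ GL(W)` with `⋀γ ω = ω`** (e.g. `γ ∈ Sp(W, ω)`, the action of
  `S(H)`): `μ_*` and `Φ` are equivariant.
* §2 (plumbing `ℚ → ℂ`) `prodRight_comp_baseChange_prod_id_id` (`β ∘ μ^*_ℂ = (v ↦ (v, v))`), `baseChange_prod_id_id_comp_eq_blockDiag_comp`
  (`μ^*_ℂ ∘ γ = (γ ⊕ γ) ∘ μ^*_ℂ`), `map_baseChange_prod_id_id_map`, **`Polarization.toComplexAlg_pontryagin`: `Θ(x ⋆ y) = (μ_*)_ℂ Θ(Φ(x ⊗ y))`**,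
  `Polarization.map_blockDiag_toComplexAlg_inl_add_inr` (`⋀(γ ⊕ γ)` fixes `Θ(E ⊞ E)`), `Polarization.map_blockDiag_toComplexAlg_kunnethEquiv_tmul`
  (`⋀(γ ⊕ γ)` fixes `Θ Φ(x ⊗ y)` for Lefschetz `x, y`).
* §3 **`Polarization.pontryagin_mem_adjoin_hodgeClasses_two`: `x, y ∈ ℚ[B¹(H)] ⟹ x ⋆ y ∈ ℚ[B¹(H)]`** (Cor. 5.5 for `μ`), the unit
  `Polarization.inv_factorial_smul_lefschetzClass_pow_mem_adjoin` (`pt = E^g/g! ∈ ℚ[B¹(H)]`), iterates `Polarization.iterate_pontryagin_mem_adjoin_hodgeClasses_two`,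
  and the graded form **`Polarization.pontryagin_mem_map_divisorClasses`: `Dᵖ ⋆ D^q ⊆ D^{p+q−g}`** (degrees by row g35-#2 `pontryagin_mem`,
  `D^r = ℚ[B¹] ∩ H^{2r}` by `Polarization.mem_divisorClasses_of_mem_adjoin_hodgeClasses_two`).

Not here: the relative product `α ⋆ β` of Lefschetz correspondences (Cor. 5.5 for `μ × 1_Y`); Hodge classes (the same argument with `Hg` in
place of `L`). TWIN NOTICE (RULING 29 bis): the torus-forms ∕ integral-HS carriers (`Geometry/Kaehler/ComplexTorusPontryagin…`,
`AlgebraicGeometry/HodgeTheory/ComplexTorusIntegralHodgeClassesPontryaginRing`) treat Pontryagin rings of HODGE classes of complex tori — other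
carriers, BY NAME, nothing imported or restated; the present statement is about Milne's LEFSCHETZ classes of an abstract polarized `ℚ`-HS.

## References

* [Milne1999LefschetzClasses] J. S. Milne, *Lefschetz classes on abelian varieties*, Duke Math. J. 96 (1999), §5 Prop. 5.4, Cor. 5.5 (p. 663),
  §4 Cor. 4.5 (p. 659), §3 p. 654 (`S(A) = S(A^r)`), §1 Prop. 1.5 / Remark 1.6 (p. 644).
* [Lange2023AbelianVarietiesComplex] H. Lange, *Abelian Varieties over the Complex Numbers* (2023), §2.5.3 (p0132), §6.2.3 (p0308).
* [BourbakiAlgebraI1989] N. Bourbaki, *Algebra I*, Ch. III §7 no. 5 Prop. 8 (extension of scalars of `⋀`), no. 7 Prop. 10.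
-/

noncomputable section

open scoped TensorProduct Nat

namespace Literature.AlgebraicGeometry.Motives

universe u

/-! ## §1 Equivariance of the Pontryagin product: `⋀γ (x ⋆ y) = ⋀γ x ⋆ ⋀γ y` -/

namespace ExteriorLefschetz

open ExteriorAlgebra

section Equivariance

variable {K : Type*} [Field K] {W₁ W₂ : Type*} [AddCommGroup W₁] [Module K W₁] [AddCommGroup W₂] [Module K W₂]

/-- `⋀(γ₁ × γ₂)(p₁^*ω₁ + p₂^*ω₂) = p₁^*(⋀γ₁ ω₁) + p₂^*(⋀γ₂ ω₂)`. [cite: BourbakiAlgebraI1989, Ch. III §7 no. 2 (functoriality) and no. 7 Prop. 10] -/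
theorem map_prodMap_map_inl_add_map_inr (γ₁ : W₁ →ₗ[K] W₁) (γ₂ : W₂ →ₗ[K] W₂) (ω₁ : ExteriorAlgebra K W₁) (ω₂ : ExteriorAlgebra K W₂) :
    ExteriorAlgebra.map (γ₁.prodMap γ₂) (ExteriorAlgebra.map (LinearMap.inl K W₁ W₂) ω₁ + ExteriorAlgebra.map (LinearMap.inr K W₁ W₂) ω₂) =
      ExteriorAlgebra.map (LinearMap.inl K W₁ W₂) (ExteriorAlgebra.map γ₁ ω₁) + ExteriorAlgebra.map (LinearMap.inr K W₁ W₂) (ExteriorAlgebra.map γ₂ ω₂) := by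
  have h1 : γ₁.prodMap γ₂ ∘ₗ LinearMap.inl K W₁ W₂ = LinearMap.inl K W₁ W₂ ∘ₗ γ₁ := by ext v <;> simp
  have h2 : γ₁.prodMap γ₂ ∘ₗ LinearMap.inr K W₁ W₂ = LinearMap.inr K W₁ W₂ ∘ₗ γ₂ := by ext v <;> simp
  rw [map_add, ← AlgHom.comp_apply, ← AlgHom.comp_apply, map_comp_map, map_comp_map, h1, h2, ← map_comp_map, ← map_comp_map,
    AlgHom.comp_apply, AlgHom.comp_apply]

variable [CharZero K] {W : Type*} [AddCommGroup W] [Module K W] {ω : ExteriorAlgebra K W} {g : ℕ}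

/-- **EQUIVARIANCE OF THE PONTRYAGIN PRODUCT: `⋀γ (x ⋆ y) = ⋀γ x ⋆ ⋀γ y` for every `γ ∈ GL(W)` with `⋀γ ω = ω`** (the symplectic group of
`ω`, containing Milne's `S(H)`): `μ_*` commutes with `⋀γ` on `H•(X)` and `⋀(γ × γ)` on `H•(X × X)` (Prop. 5.4, row g32-#6
`IsSymplectic.pushforward_map_apply`, since `μ^* ∘ γ = (γ × γ) ∘ μ^*` and `⋀(γ × γ)(ω ⊞ ω) = ω ⊞ ω`), and `⋀(γ × γ) Φ(x ⊗ y) = Φ(⋀γ x ⊗ ⋀γ y)`.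
[cite: Milne1999LefschetzClasses, §5 Prop. 5.4 (p. 663)] [cite: Lange2023AbelianVarietiesComplex, §2.5.3 (p0132, definition of the Pontryagin product)] -/
theorem IsSymplectic.map_pontryagin (hω : IsSymplectic ω g) {γ : W ≃ₗ[K] W} (hγ : ExteriorAlgebra.map (γ : W →ₗ[K] W) ω = ω) (x y : ExteriorAlgebra K W) :
    ExteriorAlgebra.map (γ : W →ₗ[K] W) (hω.pontryagin x y) =
      hω.pontryagin (ExteriorAlgebra.map (γ : W →ₗ[K] W) x) (ExteriorAlgebra.map (γ : W →ₗ[K] W) y) := by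
  have hc : ((γ.prodCongr γ : (W × W) ≃ₗ[K] (W × W)) : W × W →ₗ[K] W × W) = (γ : W →ₗ[K] W).prodMap (γ : W →ₗ[K] W) := rfl
  have hγ₁ : ExteriorAlgebra.map ((γ.prodCongr γ : (W × W) ≃ₗ[K] (W × W)) : W × W →ₗ[K] W × W)
      (ExteriorAlgebra.map (LinearMap.inl K W W) ω + ExteriorAlgebra.map (LinearMap.inr K W W) ω) =
      ExteriorAlgebra.map (LinearMap.inl K W W) ω + ExteriorAlgebra.map (LinearMap.inr K W W) ω := by
    rw [hc, map_prodMap_map_inl_add_map_inr, hγ]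
  have hT : ∀ z : ExteriorAlgebra K W, (ExteriorAlgebra.map (LinearMap.id.prod LinearMap.id : W →ₗ[K] W × W)).toLinearMap
      (ExteriorAlgebra.map (γ : W →ₗ[K] W) z) =
      ExteriorAlgebra.map ((γ.prodCongr γ : (W × W) ≃ₗ[K] (W × W)) : W × W →ₗ[K] W × W)
        ((ExteriorAlgebra.map (LinearMap.id.prod LinearMap.id : W →ₗ[K] W × W)).toLinearMap z) := fun z ↦ by
    rw [AlgHom.toLinearMap_apply, AlgHom.toLinearMap_apply, ← AlgHom.comp_apply, ← AlgHom.comp_apply, map_comp_map, map_comp_map, hc]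
    rfl
  rw [hω.pontryagin_apply, hω.pontryagin_apply, ← (hω.inl_add_inr hω).pushforward_map_apply hω hγ₁ hγ hT, hc, map_prodMap_kunnethEquiv,
    TensorProduct.map_tmul, AlgHom.toLinearMap_apply, AlgHom.toLinearMap_apply]

end Equivariance

/-! ## §2 Plumbing `ℚ → ℂ`: `μ^*_ℂ`, `γ ⊕ γ`, `β = prodRight` -/

section Complexification

variable {V : Type u} [AddCommGroup V] [Module ℚ V]

/-- `β ∘ μ^*_ℂ = (v ↦ (v, v))` on `V_ℂ`: `β((v ↦ (v,v))_ℂ (c ⊗ v)) = (c ⊗ v, c ⊗ v)`. [cite: BourbakiAlgebraI1989, Ch. II §5 no. 1 (extension of scalars commutes with products)] -/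
theorem prodRight_comp_baseChange_prod_id_id :
    (TensorProduct.prodRight ℚ ℂ ℂ V V).toLinearMap ∘ₗ (LinearMap.id.prod LinearMap.id : V →ₗ[ℚ] V × V).baseChange ℂ =
      (LinearMap.id.prod LinearMap.id : ℂ ⊗[ℚ] V →ₗ[ℂ] (ℂ ⊗[ℚ] V) × (ℂ ⊗[ℚ] V)) := by
  refine LinearMap.ext fun z ↦ ?_
  induction z using TensorProduct.induction_on with
  | zero => simp only [map_zero]
  | add a b ha hb => simp only [map_add, ha, hb]
  | tmul c v =>
    rw [LinearMap.comp_apply, LinearMap.baseChange_tmul, LinearEquiv.coe_toLinearMap]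
    show TensorProduct.prodRight ℚ ℂ ℂ V V (c ⊗ₜ[ℚ] (v, v)) = (c ⊗ₜ[ℚ] v, c ⊗ₜ[ℚ] v)
    rw [TensorProduct.prodRight_tmul]

/-- **`μ^*_ℂ ∘ γ = (γ ⊕ γ) ∘ μ^*_ℂ`** for every `γ ∈ GL(V_ℂ)` ("`φ^*` is `L`-equivariant" for `φ = μ`; `γ ⊕ γ = blockDiag (γ, γ) = β⁻¹ (γ × γ) β`).
[cite: Milne1999LefschetzClasses, §5 p. 663 (proof of Prop. 5.4) and §1 Prop. 1.5 / Remark 1.6 (p. 644)] -/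
theorem baseChange_prod_id_id_comp_eq_blockDiag_comp (γ : (ℂ ⊗[ℚ] V) ≃ₗ[ℂ] (ℂ ⊗[ℚ] V)) :
    (LinearMap.id.prod LinearMap.id : V →ₗ[ℚ] V × V).baseChange ℂ ∘ₗ (γ : ℂ ⊗[ℚ] V →ₗ[ℂ] ℂ ⊗[ℚ] V) =
      (blockDiag ℂ V V (γ, γ) : ℂ ⊗[ℚ] (V × V) →ₗ[ℂ] ℂ ⊗[ℚ] (V × V)) ∘ₗ (LinearMap.id.prod LinearMap.id : V →ₗ[ℚ] V × V).baseChange ℂ := by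
  refine LinearMap.ext fun z ↦ (TensorProduct.prodRight ℚ ℂ ℂ V V).injective ?_
  have h1 := LinearMap.congr_fun (prodRight_comp_baseChange_prod_id_id (V := V)) (γ z)
  have h2 := LinearMap.congr_fun (prodRight_comp_blockDiag (V₁ := V) (V₂ := V) γ γ) ((LinearMap.id.prod LinearMap.id : V →ₗ[ℚ] V × V).baseChange ℂ z)
  have h3 := LinearMap.congr_fun (prodRight_comp_baseChange_prod_id_id (V := V)) z
  simp only [LinearMap.comp_apply, LinearEquiv.coe_toLinearMap] at h1 h2 h3 ⊢
  rw [h1, h2, h3]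
  rfl

/-- `⋀μ^*_ℂ ∘ ⋀γ = ⋀(γ ⊕ γ) ∘ ⋀μ^*_ℂ` on `⋀_ℂ V_ℂ`. [cite: Milne1999LefschetzClasses, §5 p. 663 (proof of Prop. 5.4)] -/
theorem map_baseChange_prod_id_id_map (γ : (ℂ ⊗[ℚ] V) ≃ₗ[ℂ] (ℂ ⊗[ℚ] V)) (Y : ExteriorAlgebra ℂ (ℂ ⊗[ℚ] V)) :
    (ExteriorAlgebra.map ((LinearMap.id.prod LinearMap.id : V →ₗ[ℚ] V × V).baseChange ℂ)).toLinearMap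
        (ExteriorAlgebra.map (γ : ℂ ⊗[ℚ] V →ₗ[ℂ] ℂ ⊗[ℚ] V) Y) =
      ExteriorAlgebra.map (blockDiag ℂ V V (γ, γ) : ℂ ⊗[ℚ] (V × V) →ₗ[ℂ] ℂ ⊗[ℚ] (V × V))
        ((ExteriorAlgebra.map ((LinearMap.id.prod LinearMap.id : V →ₗ[ℚ] V × V).baseChange ℂ)).toLinearMap Y) := by
  rw [AlgHom.toLinearMap_apply, AlgHom.toLinearMap_apply, ← AlgHom.comp_apply, ← AlgHom.comp_apply, map_comp_map, map_comp_map,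
    baseChange_prod_id_id_comp_eq_blockDiag_comp]

end Complexification

end ExteriorLefschetz

/-! ## §2 (continued) and §3 On the polarized-`ℚ`-HS carrier: `Θ(x ⋆ y)`, and `ℚ[B¹(H)]` is a Pontryagin ring -/

namespace HodgeStructure

open ExteriorLefschetz ExteriorAlgebra

variable {V : Type u} [AddCommGroup V] [Module ℚ V] [Module.Finite ℚ V] {n : ℤ} {H : HodgeStructure V n} (Q : Polarization H) (hn : Odd n)
  {g : ℕ} (hg : Module.finrank ℚ V = 2 * g)

include hg in
/-- `dim (V ⊕ V) = 2(g + g)` (bookkeeping). [cite: Milne1999LefschetzClasses, §3 p. 654] -/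
theorem finrank_prod_self_eq : Module.finrank ℚ (V × V) = 2 * (g + g) := by
  rw [Module.finrank_prod, hg]; ring

include hn hg in
/-- `Θ(E ⊞ E)` is symplectic of genus `g + g` (`E ⊞ E = E_{Q ⊕ Q}`, row g32 `Polarization.coe_lefschetzClass_prod`). [cite: Lange2023AbelianVarietiesComplex, §7.3.2 (p. 338)] -/
theorem Polarization.isSymplectic_toComplexAlg_inl_add_inr :
    IsSymplectic (toComplexAlg (V × V) (ExteriorAlgebra.map (LinearMap.inl ℚ V V) (Q.lefschetzClass : ExteriorAlgebra ℚ V) +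
      ExteriorAlgebra.map (LinearMap.inr ℚ V V) (Q.lefschetzClass : ExteriorAlgebra ℚ V))) (g + g) := by
  rw [← Q.coe_lefschetzClass_prod Q]
  exact (Q.prod Q).isSymplectic_toComplexAlg_lefschetzClass hn (finrank_prod_self_eq hg)

include hn hg in
/-- **`Θ(x ⋆ y) = (μ_*)_ℂ Θ(p₁^*x ∪ p₂^*y)`**: the complexification of the Pontryagin product is the Gysin map (for the orientations `Θ(E ⊞ E)`,
`Θ E`) of `μ^*_ℂ = ⋀((v ↦ (v, v))_ℂ)` applied to `Θ Φ(x ⊗ y)` — Prop. 5.4's `(φ_*)_ℂ Θ = Θ φ_*` (row g32-#6 `pushforward_toComplexAlg_apply`)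
for `φ = μ`. [cite: Milne1999LefschetzClasses, §5 Prop. 5.4 (p. 663)] [cite: BourbakiAlgebraI1989, Ch. III §7 no. 5 Prop. 8] -/
theorem Polarization.toComplexAlg_pontryagin (x y : ExteriorAlgebra ℚ V) :
    toComplexAlg V ((Q.isSymplectic_lefschetzClass hn hg).pontryagin x y) =
      (Q.isSymplectic_toComplexAlg_lefschetzClass hn hg).pushforward
          (toComplexAlg (V × V) (ExteriorAlgebra.map (LinearMap.inl ℚ V V) (Q.lefschetzClass : ExteriorAlgebra ℚ V) +
            ExteriorAlgebra.map (LinearMap.inr ℚ V V) (Q.lefschetzClass : ExteriorAlgebra ℚ V))) (g + g)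
          (ExteriorAlgebra.map ((LinearMap.id.prod LinearMap.id : V →ₗ[ℚ] V × V).baseChange ℂ)).toLinearMap
        (toComplexAlg (V × V) (kunnethEquiv ℚ V V (x ⊗ₜ[ℚ] y))) := by
  rw [(Q.isSymplectic_lefschetzClass hn hg).pontryagin_apply,
    ((Q.isSymplectic_lefschetzClass hn hg).inl_add_inr (Q.isSymplectic_lefschetzClass hn hg)).pushforward_toComplexAlg_apply
      (Q.isSymplectic_toComplexAlg_inl_add_inr hn hg) (Q.isSymplectic_lefschetzClass hn hg) (Q.isSymplectic_toComplexAlg_lefschetzClass hn hg)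
      (fun z ↦ by rw [AlgHom.toLinearMap_apply, AlgHom.toLinearMap_apply, toComplexAlg_map])]

include hn in
/-- **`⋀(γ ⊕ γ)` fixes `Θ(E ⊞ E)` for `γ ∈ S(H)(ℂ)`** (`γ ⊕ γ ∈ S(H ⊕ H)(ℂ)` by "`S(A) = S(A^r)`", and `S` fixes the complexified divisor class
`Θ E_{Q ⊕ Q}`, Cor. 4.5). [cite: Milne1999LefschetzClasses, §3 p. 654 and §4 Cor. 4.5 (p. 659)] -/
theorem Polarization.map_blockDiag_toComplexAlg_inl_add_inr {γ : (ℂ ⊗[ℚ] V) ≃ₗ[ℂ] (ℂ ⊗[ℚ] V)} (hγ : γ ∈ Q.lefschetzGroupBaseChange ℂ) :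
    ExteriorAlgebra.map (blockDiag ℂ V V (γ, γ) : ℂ ⊗[ℚ] (V × V) →ₗ[ℂ] ℂ ⊗[ℚ] (V × V))
        (toComplexAlg (V × V) (ExteriorAlgebra.map (LinearMap.inl ℚ V V) (Q.lefschetzClass : ExteriorAlgebra ℚ V) +
          ExteriorAlgebra.map (LinearMap.inr ℚ V V) (Q.lefschetzClass : ExteriorAlgebra ℚ V))) =
      toComplexAlg (V × V) (ExteriorAlgebra.map (LinearMap.inl ℚ V V) (Q.lefschetzClass : ExteriorAlgebra ℚ V) +
        ExteriorAlgebra.map (LinearMap.inr ℚ V V) (Q.lefschetzClass : ExteriorAlgebra ℚ V)) := by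
  rw [← Q.coe_lefschetzClass_prod Q]
  exact (Q.prod Q).map_toComplexAlg_lefschetzClass_eq_of_mem_lefschetzGroupBaseChange hn
    ((Q.blockDiag_mem_lefschetzGroupBaseChange_prod_self_iff γ γ).2 ⟨hγ, rfl⟩)

include hn in
/-- **`⋀(γ ⊕ γ)` fixes `Θ(p₁^*x ∪ p₂^*y)` for Lefschetz `x, y` and `γ ∈ S(H)(ℂ)`**: under `⋀β`, `Θ Φ(x ⊗ y) = Φ_ℂ(Θx ⊗ Θy)` and
`⋀(γ ⊕ γ)` becomes `⋀(γ × γ)`, which acts by `Φ_ℂ(⋀γ Θx ⊗ ⋀γ Θy)`; `⋀γ Θx = Θx`, `⋀γ Θy = Θy` (Cor. 4.5). [cite: Milne1999LefschetzClasses, §4 Cor. 4.5 (p. 659) and §5 p. 663] [cite: BourbakiAlgebraI1989, Ch. III §7 no. 5 Prop. 8 and no. 7 Prop. 10] -/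
theorem Polarization.map_blockDiag_toComplexAlg_kunnethEquiv_tmul {x y : ExteriorAlgebra ℚ V}
    (hx : x ∈ Algebra.adjoin ℚ (((H.exteriorPower 2).hodgeClasses n).map (⋀[ℚ]^2 V).subtype : Set (ExteriorAlgebra ℚ V)))
    (hy : y ∈ Algebra.adjoin ℚ (((H.exteriorPower 2).hodgeClasses n).map (⋀[ℚ]^2 V).subtype : Set (ExteriorAlgebra ℚ V)))
    {γ : (ℂ ⊗[ℚ] V) ≃ₗ[ℂ] (ℂ ⊗[ℚ] V)} (hγ : γ ∈ Q.lefschetzGroupBaseChange ℂ) :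
    ExteriorAlgebra.map (blockDiag ℂ V V (γ, γ) : ℂ ⊗[ℚ] (V × V) →ₗ[ℂ] ℂ ⊗[ℚ] (V × V)) (toComplexAlg (V × V) (kunnethEquiv ℚ V V (x ⊗ₜ[ℚ] y))) =
      toComplexAlg (V × V) (kunnethEquiv ℚ V V (x ⊗ₜ[ℚ] y)) := by
  have hx' := (Q.mem_adjoin_hodgeClasses_two_iff_forall_map_toComplexAlg_eq hn x).1 hx γ hγ
  have hy' := (Q.mem_adjoin_hodgeClasses_two_iff_forall_map_toComplexAlg_eq hn y).1 hy γ hγ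
  apply map_equiv_injective (TensorProduct.prodRight ℚ ℂ ℂ V V)
  rw [map_prodRight_map_blockDiag, map_prodRight_toComplexAlg_kunnethEquiv_tmul, map_prodMap_kunnethEquiv, TensorProduct.map_tmul,
    AlgHom.toLinearMap_apply, AlgHom.toLinearMap_apply, hx', hy']

include hn hg in
/-- **MILNE 1999, COR. 5.5 FOR THE ADDITION MAP: THE PONTRYAGIN PRODUCT OF LEFSCHETZ CLASSES IS A LEFSCHETZ CLASS — `x, y ∈ ℚ[B¹(H)] ⟹
x ⋆ y = μ_*(p₁^*x ∪ p₂^*y) ∈ ℚ[B¹(H)]`**; with rows g35-#2/#4 (unit `pt = E^g/g!`, associativity, graded commutativity) `(ℚ[B¹(H)], +, ⋆)` is a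
commutative ring ("commutative associative graded rings with identity", §6.2.3). Proof as printed: `Θ(x ⋆ y) = (μ_*)_ℂ Θ Φ(x ⊗ y)` is fixed by
every `γ ∈ S(H)(ℂ)` because `(μ_*)_ℂ ∘ ⋀(γ ⊕ γ) = ⋀γ ∘ (μ_*)_ℂ` (Prop. 5.4) and `⋀(γ ⊕ γ)` fixes `Θ Φ(x ⊗ y)`; conclude by Cor. 4.5.
[cite: Milne1999LefschetzClasses, §5 Prop. 5.4, Cor. 5.5 (p. 663) and §4 Cor. 4.5 (p. 659)] [cite: Lange2023AbelianVarietiesComplex, §6.2.3 (p0308, "commutative associative graded rings with identity")] -/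
theorem Polarization.pontryagin_mem_adjoin_hodgeClasses_two {x y : ExteriorAlgebra ℚ V}
    (hx : x ∈ Algebra.adjoin ℚ (((H.exteriorPower 2).hodgeClasses n).map (⋀[ℚ]^2 V).subtype : Set (ExteriorAlgebra ℚ V)))
    (hy : y ∈ Algebra.adjoin ℚ (((H.exteriorPower 2).hodgeClasses n).map (⋀[ℚ]^2 V).subtype : Set (ExteriorAlgebra ℚ V))) :
    (Q.isSymplectic_lefschetzClass hn hg).pontryagin x y ∈
      Algebra.adjoin ℚ (((H.exteriorPower 2).hodgeClasses n).map (⋀[ℚ]^2 V).subtype : Set (ExteriorAlgebra ℚ V)) := by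
  rw [Q.mem_adjoin_hodgeClasses_two_iff_forall_map_toComplexAlg_eq hn]
  intro γ hγ
  rw [Q.toComplexAlg_pontryagin hn hg,
    ← (Q.isSymplectic_toComplexAlg_inl_add_inr hn hg).pushforward_map_apply (Q.isSymplectic_toComplexAlg_lefschetzClass hn hg)
      (Q.map_blockDiag_toComplexAlg_inl_add_inr hn hγ) (Q.map_toComplexAlg_lefschetzClass_eq_of_mem_lefschetzGroupBaseChange hn hγ)
      (map_baseChange_prod_id_id_map γ),
    Q.map_blockDiag_toComplexAlg_kunnethEquiv_tmul hn hx hy hγ]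

/-- The Lefschetz class itself: `E ∈ ℚ[B¹(H)]`. [cite: Milne1999LefschetzClasses, §3 p. 653 (the class of a polarization is a divisor class)] -/
theorem Polarization.coe_lefschetzClass_mem_adjoin_hodgeClasses_two :
    (Q.lefschetzClass : ExteriorAlgebra ℚ V) ∈
      Algebra.adjoin ℚ (((H.exteriorPower 2).hodgeClasses n).map (⋀[ℚ]^2 V).subtype : Set (ExteriorAlgebra ℚ V)) :=
  Algebra.subset_adjoin (Submodule.mem_map.2 ⟨Q.lefschetzClass, Q.lefschetzClass_mem_hodgeClasses, rfl⟩)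

/-- **The unit `pt = E^g/g!` of the Pontryagin ring is a Lefschetz class** (row g35-#2 `pontryagin_point_left/right`). [cite: Milne1999LefschetzClasses, §3 p. 653] [cite: Lange2023AbelianVarietiesComplex, §6.2.3 (p0308, "with identity (0)_X")] -/
theorem Polarization.inv_factorial_smul_lefschetzClass_pow_mem_adjoin (k : ℕ) :
    ((k ! : ℚ)⁻¹ • (Q.lefschetzClass : ExteriorAlgebra ℚ V) ^ k) ∈
      Algebra.adjoin ℚ (((H.exteriorPower 2).hodgeClasses n).map (⋀[ℚ]^2 V).subtype : Set (ExteriorAlgebra ℚ V)) :=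
  Subalgebra.smul_mem _ (Subalgebra.pow_mem _ Q.coe_lefschetzClass_mem_adjoin_hodgeClasses_two k) _

include hn hg in
/-- **Pontryagin powers of Lefschetz classes are Lefschetz: `(x ⋆)^k y ∈ ℚ[B¹(H)]`** (e.g. the divided powers `c^{⋆k}` of Poincaré's formula).
[cite: Milne1999LefschetzClasses, §5 Cor. 5.5 (p. 663)] [cite: Lange2023AbelianVarietiesComplex, §6.2.3 (p0308)] -/
theorem Polarization.iterate_pontryagin_mem_adjoin_hodgeClasses_two {x y : ExteriorAlgebra ℚ V}
    (hx : x ∈ Algebra.adjoin ℚ (((H.exteriorPower 2).hodgeClasses n).map (⋀[ℚ]^2 V).subtype : Set (ExteriorAlgebra ℚ V)))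
    (hy : y ∈ Algebra.adjoin ℚ (((H.exteriorPower 2).hodgeClasses n).map (⋀[ℚ]^2 V).subtype : Set (ExteriorAlgebra ℚ V))) (k : ℕ) :
    ((Q.isSymplectic_lefschetzClass hn hg).pontryagin x)^[k] y ∈
      Algebra.adjoin ℚ (((H.exteriorPower 2).hodgeClasses n).map (⋀[ℚ]^2 V).subtype : Set (ExteriorAlgebra ℚ V)) := by
  induction k with
  | zero => exact hy
  | succ k ih => rw [Function.iterate_succ_apply']; exact Q.pontryagin_mem_adjoin_hodgeClasses_two hn hg hx ih

include hn hg in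
/-- **Graded form `Dᵖ(H) ⋆ D^q(H) ⊆ D^r(H)`, `p + q = g + r`**: for Lefschetz classes `x ∈ H^{2p}`, `y ∈ H^{2q}` the class `x ⋆ y` lies in
`D^r(H) = ℚ[B¹(H)] ∩ H^{2r}` (degrees: `H^a ⋆ H^b ⊆ H^{a+b−2g}`, row g35-#2 `pontryagin_mem`; `D^r` = the Lefschetz classes of degree `2r`, row
g23 `Polarization.mem_divisorClasses_of_mem_adjoin_hodgeClasses_two`). [cite: Milne1999LefschetzClasses, §5 Cor. 5.5 (p. 663) and §2 (the graded pieces D^p)] -/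
theorem Polarization.pontryagin_mem_map_divisorClasses {p q r : ℕ} (hpq : p + q = g + r) {x y : ExteriorAlgebra ℚ V} (hxp : x ∈ ⋀[ℚ]^(2 * p) V)
    (hyq : y ∈ ⋀[ℚ]^(2 * q) V)
    (hx : x ∈ Algebra.adjoin ℚ (((H.exteriorPower 2).hodgeClasses n).map (⋀[ℚ]^2 V).subtype : Set (ExteriorAlgebra ℚ V)))
    (hy : y ∈ Algebra.adjoin ℚ (((H.exteriorPower 2).hodgeClasses n).map (⋀[ℚ]^2 V).subtype : Set (ExteriorAlgebra ℚ V))) :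
    (Q.isSymplectic_lefschetzClass hn hg).pontryagin x y ∈ (H.divisorClasses r).map (⋀[ℚ]^(2 * r) V).subtype :=
  Submodule.mem_map.2 ⟨⟨_, (Q.isSymplectic_lefschetzClass hn hg).pontryagin_mem (r := 2 * r) (by omega) hxp hyq⟩,
    Q.mem_divisorClasses_of_mem_adjoin_hodgeClasses_two hn (Q.pontryagin_mem_adjoin_hodgeClasses_two hn hg hx hy), rfl⟩

end HodgeStructure

end Literature.AlgebraicGeometry.Motives
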